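import Summits.ResolutionOfSingularities.ResolutionOfSingularities.Theorems.HilbertSamuelEliminationSigmaMaxModificationsCorridor3ConfinementImage
import Summits.ResolutionOfSingularities.ResolutionOfSingularities.Theorems.HilbertSamuelEliminationSigmaMaxModificationsCorridor3ConfinementLocal
import Literature.AlgebraicGeometry.Resolution.SigmaMaxEliminationInDim
import Literature.AlgebraicGeometry.Resolution.BlowupSequencesAppend
import HarnessLib

/-!
# Route `HilbertSamuelElimination`, crux `SigmaMaxModificationsCorridor3`
# (stmt-ResolutionOfSingularities-19249; child of `SigmaMaxModifications` stmt-…-18506),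
# line `tame_wild` v3: CONFINEMENT ladder, row C6 — the noetherian induction (rounds confine)

[OURS · L1 W4.2] Row C6 of `L/w42/helpers-v3.1.lean` (CHAIN v3.1 §5, stub-1 + stub-3): the conclusion
of `TameWild.stub_confine3` (tame_wild v3, verbatim binders of `stub_C6_confine3_of_confineRound`) from a
ROUND LEMMA. The typed `ConfineRound` (C5) does not export the decrease `T' ⊆ T` of the image of the top
stratum along a round, which the induction needs (flagged `stub-misstated` on STATUS 2026-08-27); this file
takes the round lemma in the REPAIRED shape — `ConfineRound` plus the conjunct
`comp'(top'(ν)) ⊆ comp(top(ν))` — as an inline hypothesis (`confine3_of_confineRound'`).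

Induction (well-founded on the closed subsets of the Noetherian `Y`): for a partial sequence `s`
(regular centres over `Y(ν)`, `H^3`-monotone) let `T = s.comp(s.top(ν))`; it is closed
(`isClosed_image_hsStratum_of_universallyClosed`, `…Corridor3ConfinementImage.lean`). If every point
of `T` is closed, `T` is finite (C1, `…Corridor3ConfinementLocal.lean`) and `s` confines. Otherwise `T`
has a non-closed point maximal for generisation (`exists_maximal_not_isClosed_of_mem`); the round lemma
extends `s` to `s.append t` with `ξ ∉ T' ⊆ T`, so `T' < T` and the induction hypothesis applies.
Start: `s = nil`, `T = Y(ν)`. NOT a statement of any manuscript.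

## Sources

* V. Cossart, U. Jannsen, S. Saito, LNM 2270 (2020), Rem. 6.29, Thm. 6.28, Def. 6.14.
  [CossartJannsenSaito2020]
* The Stacks Project, Tag 0052 (Noetherian induction). [StacksProject]
-/

set_option linter.dupNamespace false -- mandated namespace of this single-conjunct summit

noncomputable section

open CategoryTheory AlgebraicGeometry TopologicalSpace Topology Order
open Literature.AlgebraicGeometry.Resolution Literature.RingTheory.HilbertSamuel

namespace Summit.ResolutionOfSingularities.ResolutionOfSingularities.Theorems.SigmaMaxModificationsCorridor3.Helpers

/-- **C6: rounds confine** — the conclusion of `TameWild.stub_confine3` from the round lemma in the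
repaired shape (`ConfineRound` of `L/w42/helpers-v3.1.lean` with the extra conjunct `T' ⊆ T`): for a
reduced threefold `Y/k` of characteristic `p`, a maximal value `ν ≠ Φ^{(3)}`, there is a blow-up
sequence in regular centres over `Y(ν)`, `H^3`-monotone, whose top `ν`-stratum lies over finitely many
closed points of `Y` (noetherian induction on the closed image `T` of the top stratum; terminal `T` =
closed points, finite by C1). [OURS · L1 W4.2] row C6 of CHAIN v3.1; NOT a statement of the
manuscript. [cite: CossartJannsenSaito2020, Rem. 6.29] [cite: StacksProject, Tag 0052] -/
theorem confine3_of_confineRound'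
    (hround : ∀ p : ℕ, p.Prime → ∀ (k : Type) [Field k] [CharP k p] (Y : Scheme.{0})
      (g : Y ⟶ Spec (.of k)), IsSeparated g → LocallyOfFiniteType g → QuasiCompact g →
      IsReduced Y → topologicalKrullDim Y ≤ ((3 : ℕ) : WithBot ℕ∞) →
      ∀ ν : ℕ → ℕ, Maximal (· ∈ Scheme.hsValues Y 3) ν → ν ≠ iterPSum 3 Phi →
        ∀ s : CentreSeq Y, s.AllRegular → s.CentresOver (Scheme.hsStratum Y 3 ν) →
          (∀ x' : s.top, Scheme.hsFun s.top 3 x' ≤ Scheme.hsFun Y 3 (s.comp.base x')) →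
          ∀ ξ ∈ (fun x' => s.comp.base x') '' Scheme.hsStratum s.top 3 ν,
            ¬ IsClosed ({ξ} : Set Y) →
            (∀ η ∈ (fun x' => s.comp.base x') '' Scheme.hsStratum s.top 3 ν, η ⤳ ξ → η = ξ) →
            ∃ t : CentreSeq s.top,
              (s.append t).AllRegular ∧ (s.append t).CentresOver (Scheme.hsStratum Y 3 ν) ∧
              (∀ x'' : (s.append t).top,
                Scheme.hsFun (s.append t).top 3 x'' ≤
                  Scheme.hsFun Y 3 ((s.append t).comp.base x'')) ∧
              ξ ∉ (fun x'' => (s.append t).comp.base x'') '' Scheme.hsStratum (s.append t).top 3 ν ∧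
              (fun x'' => (s.append t).comp.base x'') '' Scheme.hsStratum (s.append t).top 3 ν ⊆
                (fun x' => s.comp.base x') '' Scheme.hsStratum s.top 3 ν) :
    ∀ p : ℕ, p.Prime → ∀ (k : Type) [Field k] [CharP k p] (Y : Scheme.{0})
      (g : Y ⟶ Spec (.of k)), IsSeparated g → LocallyOfFiniteType g → QuasiCompact g →
      IsReduced Y → ((3 : ℕ) : WithBot ℕ∞) ≤ topologicalKrullDim Y →
      topologicalKrullDim Y ≤ ((3 : ℕ) : WithBot ℕ∞) →
      ∀ ν : ℕ → ℕ, Maximal (· ∈ Scheme.hsValues Y 3) ν → ν ≠ iterPSum 3 Phi →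
        ¬ Disjoint (closure ((Scheme.regularLocus Y)ᶜ \ Scheme.hsStratum Y 3 ν))
            (Scheme.hsStratum Y 3 ν) →
        ∃ s : CentreSeq Y, s.AllRegular ∧ s.CentresOver (Scheme.hsStratum Y 3 ν) ∧
          (∀ x' : s.top, Scheme.hsFun s.top 3 x' ≤ Scheme.hsFun Y 3 (s.comp.base x')) ∧
          ((fun x' => s.comp.base x') '' Scheme.hsStratum s.top 3 ν).Finite ∧
          ∀ y ∈ (fun x' => s.comp.base x') '' Scheme.hsStratum s.top 3 ν, IsClosed ({y} : Set Y) := by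
  intro p hp k _ _ Y g hsep hft hqc hred _ hd3 ν hν hνΦ _
  haveI := hft
  haveI := hqc
  haveI := hred
  haveI : IsLocallyNoetherian Y := LocallyOfFiniteType.isLocallyNoetherian g
  haveI : IsNoetherian Y := Scheme.isNoetherian_of_finiteType_over_field g
  -- the image of the top stratum of a partial sequence is closed
  have hTcl : ∀ s : CentreSeq Y,
      (∀ x' : s.top, Scheme.hsFun s.top 3 x' ≤ Scheme.hsFun Y 3 (s.comp.base x')) →
      IsClosed ((fun x' => s.comp.base x') '' Scheme.hsStratum s.top 3 ν) := by
    intro s hmono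
    haveI : IsProper s.comp := s.isProper_comp
    exact isClosed_image_hsStratum_of_universallyClosed (s.comp ≫ g) s.comp 3
      (s.topologicalKrullDim_top_le hd3) hν hmono
  -- noetherian induction on the closed image `T`
  have key : ∀ (T : Closeds Y) (s : CentreSeq Y), s.AllRegular →
      s.CentresOver (Scheme.hsStratum Y 3 ν) →
      (∀ x' : s.top, Scheme.hsFun s.top 3 x' ≤ Scheme.hsFun Y 3 (s.comp.base x')) →
      (fun x' => s.comp.base x') '' Scheme.hsStratum s.top 3 ν = (T : Set Y) →
      ∃ s' : CentreSeq Y, s'.AllRegular ∧ s'.CentresOver (Scheme.hsStratum Y 3 ν) ∧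
        (∀ x' : s'.top, Scheme.hsFun s'.top 3 x' ≤ Scheme.hsFun Y 3 (s'.comp.base x')) ∧
        ((fun x' => s'.comp.base x') '' Scheme.hsStratum s'.top 3 ν).Finite ∧
        ∀ y ∈ (fun x' => s'.comp.base x') '' Scheme.hsStratum s'.top 3 ν,
          IsClosed ({y} : Set Y) := by
    intro T
    induction T using WellFoundedLT.induction with | ind T ih =>
    intro s hreg hover hmono hT
    by_cases hall : ∀ y ∈ (T : Set Y), IsClosed ({y} : Set Y)
    · -- terminal: all points of `T` are closed, so `T` is finite (C1)
      refine ⟨s, hreg, hover, hmono, ?_, ?_⟩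
      · rw [hT]
        exact stub_C1_finite_of_isClosed_of_forall_isClosed_singleton Y T T.isClosed hall
      · rw [hT]
        exact hall
    · -- a round at a maximal non-closed point of `T`
      push Not at hall
      obtain ⟨ξ₀, hξ₀T, hξ₀⟩ := hall
      obtain ⟨ξ, hξT, hξ, hmax⟩ := exists_maximal_not_isClosed_of_mem T.isClosed hξ₀T hξ₀
      rw [← hT] at hξT hmax
      obtain ⟨t, hreg', hover', hmono', hξ', hsub⟩ :=
        hround p hp k Y g hsep hft hqc hred hd3 ν hν hνΦ s hreg hover hmono ξ hξT hξ hmax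
      let T' : Closeds Y := ⟨_, hTcl (s.append t) hmono'⟩
      have hlt : T' < T := by
        refine lt_of_le_of_ne ?_ ?_
        · intro y hy
          have hy' := hsub hy
          rw [hT] at hy'
          exact hy'
        · intro he
          apply hξ'
          have hξT' : ξ ∈ (T : Set Y) := by rw [← hT]; exact hξT
          rw [← he] at hξT'
          exact hξT'
      exact ih T' hlt (s.append t) hreg' hover' hmono' rfl
  -- start from the empty sequence: `T = Y(ν)`
  have hmono₀ : ∀ x' : (CentreSeq.nil Y).top,
      Scheme.hsFun (CentreSeq.nil Y).top 3 x' ≤ Scheme.hsFun Y 3 ((CentreSeq.nil Y).comp.base x') :=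
    fun _ => le_rfl
  exact key ⟨_, hTcl (CentreSeq.nil Y) hmono₀⟩ (CentreSeq.nil Y) trivial trivial hmono₀ rfl

end Summit.ResolutionOfSingularities.ResolutionOfSingularities.Theorems.SigmaMaxModificationsCorridor3.Helpers

end
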